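import Summits.HodgeConjecture.HodgeConjecture.Theorems.Ring2HypothesesDescentMotivatedExteriorSumHardLefschetz
import Summits.HodgeConjecture.HodgeConjecture.Theorems.Ring2AbelianAllAndrePrimitiveProjectorAlgebraic
import Summits.HodgeConjecture.HodgeConjecture.Theorems.Ring2AbelianAllAndreFibreClassDivisorRung
import Summits.HodgeConjecture.HodgeConjecture.Theorems.Ring2AbelianAllAndrePrimitiveLiftLefschetzDegreeNodes
import HarnessLib

/-!
# Ring 2 · §AbelianAll (seat `ab-andre-1`), XIV-f(1) — KLEIMAN'S LOWERING OPERATOR UNDER `A`: an `𝔰𝔩₂`-lowering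
# `Λ` for a divisor class `ω` with `A(Y, ω)` preserves algebraic classes; `Λ` is cup-self-adjoint in complementary
# degrees; its iterates `Λʳ : H^{n+r} → H^{n-r}` are injective, and algebraic once `Λ` is (inputs of `A(X × X) ⟹ B⋆(X)`)

HONEST FRAMING: research route, not a corollary; conditional on HC_CM plus one named minimal statement.
(Cell line: research route conditional on HC_CM; not a corollary; Q11.4-sentence-2 already refuted in dim ≥ 3.)
This file proves NO case of the Hodge conjecture and NO standard conjecture. It is part (1) of the port, to the
cell's REAL carriers (`complexBetti`, `algebraicClasses`/`supportedClasses`, `StandardConjectureA`,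
`IsAlgebraicCorrespondence`), of Kleiman's proof of `A(X × X) ⟹ B(X)` (Kleiman 1968 Thm. 2.9; Grothendieck §3 p. 196;
Kleiman 1994 Thm. 4-1); part (2), `Ring2AbelianAllStandardAPencilsKleimanSquare`, assembles
`A(X ⊗ X, η ⊠ 1 + 1 ⊠ η) ⟹ B⋆(X, η)` and the letter circle `(∀ X, A(X)) ⟺ (∀ X, B⋆(X))`. (The abstract-Weil-cohomology
version in the tree, `Literature.AlgebraicGeometry.Motives.StandardConjecturesLefschetzOfHomNumProofs`, has no bridge
to `complexBetti`; the port is by hand over b05's `𝔰𝔩₂` files.)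

CONTENT.
* §1 (formal, any space `Y`, any `θ ∈ H²`, any family `Λ` with `[L_θ, Λ] = deg - N`): `Λ` kills every class killed by
  `L^{w+1}` (`d + w = N`) — "`Λ` vanishes on primitive classes" for an ARBITRARY operator with the relation
  (`sl2_lefschetzPow_lowering_sub` + `sl2_lefschetzPow_injective`).
* §2 (β) for `Y/ℂ` smooth projective of dimension `N`, `ω ∈ N¹H²` with `A(Y, ω)` and such a `Λ`:
  `Λ (Nᵖ H²ᵖ) ⊆ Nᵖ⁻¹ H²ᵖ⁻²` — strong induction on `p`; `A` says `L_ω` is invertible ON ALGEBRAIC CLASSES and the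
  relation expresses `Λ` through `L_ω` (below the middle: `x - L x''` is killed by `L^{w+1}`; above: `x = Lʳ x''`).
* §3 (generic coefficients) Lefschetz strings of different primitive degrees are cup-orthogonal (Voisin I Lemma 6.31),
  and the lowering operator with the string formulas of `exists_sl2Lowering` is SELF-ADJOINT for the cup product in
  complementary degrees: `c ∪ Λ y = Λ c ∪ y` (`lefschetz_span_induction` twice).
* §4 (δ) if `Λ : Hᵃ → Hᵃ⁻²` is an algebraic correspondence in every degree `a ≤ 2n` then for `b + r = n` the iterate
  `Λʳ : H^{b+2r} → Hᵇ` is an INJECTIVE algebraic correspondence (`Λʳ L^{t+r} x = c Lᵗ x` on strings with an integer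
  `c ≠ 0`; uniqueness of the Lefschetz decomposition `primitivePart_eq_of_sum_eq`) — the input of ab-andre-2's
  `ν`-criterion `standardConjectureBStar_of_nu` (XXII-b).

COUNT ONCE — used BY NAME, not restated: b05 (`…ExteriorSumSl2Lowering/ExteriorSumHardLefschetz`):
`lefschetz_span_induction`, `sl2_lefschetzPow_lowering_sub`, `sl2_lowering_lefschetzPow_of_le_one`,
`sl2_lefschetzPow_injective`, `lefschetzPowTo_comp_apply`; ab-andre-2: `IsAlgebraicCorrespondence.comp` (XXII-e),
`isAlgebraicCorrespondence_id`, `lefschetzPowTo_mem_supportedClasses_of_mem`,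
`exists_eq_lefschetzPowTo_of_standardConjectureA`; Literature: `cupProduct_lefschetzPowTo_lefschetzPowTo`, `lefschetzPowTo_congr_exponent`,
`lefschetzPowTo_lefschetzPowTo`, `lefschetzPowTo_eq_zero_of_mem_primitiveClasses`, `sum_lefschetzPowTo_primitivePart`,
`primitivePart_eq_of_sum_eq`, `primitivePart_mem`, `primitivePart_of_lt`, `cupProduct_gradedComm_holds`,
`subsingleton_complexBetti`.

No definition, no named fact, no sorry.

References: Kleiman1968AlgebraicCycles (§1.4 (1.4.6); §2 Prop. 2.3; Thm. 2.9), Grothendieck1968 (§3 p. 196 (A(X))),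
Kleiman1994StandardConjectures (Thm. 4-1), VoisinHodgeI2002 (§6.2.2 Lemma 6.24, §6.2.3 Cor. 6.26, §6.3.2 Lemma 6.31),
VoisinHodgeII2003 (§9.2.4 Prop. 9.20), HatcherAT2002 (§3.2 Thm. 3.11).
-/

noncomputable section

set_option linter.dupNamespace false

namespace Summit.HodgeConjecture.HodgeConjecture.Ring2.AbelianAll

open CategoryTheory AlgebraicGeometry MonoidalCategory CartesianMonoidalCategory
open Literature.AlgebraicGeometry Literature.AlgebraicGeometry.Motives
open Literature.AlgebraicGeometry.HodgeTheory
open Literature.AlgebraicTopology.SingularHomology Literature.Geometry.Kaehler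
open Summit.HodgeConjecture.HodgeConjecture.Theorems

universe u

/-! ## §1 An operator with the `𝔰𝔩₂` relation kills the classes killed by `L^{w+1}` (`d + w = N`) -/

section Formal

variable {Y : Type} [TopologicalSpace Y] (θ : singularCohomology ℂ ℂ Y 2) (N : ℕ)
  (Λ : (a b : ℕ) → singularCohomology ℂ ℂ Y a →ₗ[ℂ] singularCohomology ℂ ℂ Y b)
  (hR : ∀ {c d e : ℕ} (hcd : c + 2 * 1 = d) (hde : d + 2 * 1 = e) (y : singularCohomology ℂ ℂ Y d),
    lefschetzPowTo θ 1 c d hcd (Λ d c y) - Λ e d (lefschetzPowTo θ 1 d e hde y) =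
      ((((d : ℤ) - N) : ℤ) : ℂ) • y)
  (hR₁ : ∀ {d e : ℕ} (_ : d ≤ 1) (hde : d + 2 * 1 = e) (y : singularCohomology ℂ ℂ Y d),
    Λ e d (lefschetzPowTo θ 1 d e hde y) = ((((N : ℤ) - d) : ℤ) : ℂ) • y)

include hR hR₁ in
/-- **`Λ` kills what `L^{w+1}` kills** (`d + w = N`, `d ≥ 2`): if `L^{w+1} v = 0` for `v ∈ Hᵈ(Y; ℂ)` then `Λ v = 0`.
By the commutator identity `L^{w+2} (Λ v) = Λ (L^{w+2} v) + (w+2)(d - N + w + 1) L^{w+1} v = 0`, and `L^{w+2}` is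
injective on `H^{d-2}` (`(d - 2) + (w + 2) = N`, hard Lefschetz from the relation, `sl2_lefschetzPow_injective`). This is
the statement "`Λ` vanishes on the primitive classes" for an arbitrary operator with the relation.
[cite: Kleiman1968AlgebraicCycles, §1.4 (1.4.6)] [cite: VoisinHodgeI2002, §6.2.2 Lemma 6.24] -/
theorem sl2_lowering_eq_zero_of_lefschetzPow_eq_zero {c d w e : ℕ} (hcd : c + 2 = d) (hdw : d + w = N)
    (he : d + 2 * (w + 1) = e) (v : singularCohomology ℂ ℂ Y d) (hv : lefschetzPowTo θ (w + 1) d e he v = 0) :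
    Λ d c v = 0 := by
  have hinj := sl2_lefschetzPow_injective θ N Λ hR hR₁ c (w := w + 1 + 1) (e := c + 2 * (w + 1 + 1)) (by omega) rfl
  refine (injective_iff_map_eq_zero _).mp hinj _ ?_
  have key := sl2_lefschetzPow_lowering_sub θ N Λ hR hcd v (w + 1)
    (cs := c + 2 * (w + 1 + 1)) (ds := d + 2 * (w + 1 + 1)) rfl rfl (by omega)
  have h2 : lefschetzPowTo θ (w + 1 + 1) d (d + 2 * (w + 1 + 1)) rfl v = 0 := by
    rw [← lefschetzPowTo_comp_apply θ (show w + 1 + 1 = w + 1 + 1 from rfl) he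
      (show e + 2 * 1 = d + 2 * (w + 1 + 1) by omega) rfl v, hv, map_zero]
  have h1 : lefschetzPowTo θ (w + 1) d (c + 2 * (w + 1 + 1)) (by omega) v = 0 := by
    obtain rfl : e = c + 2 * (w + 1 + 1) := by omega
    exact hv
  rwa [h2, map_zero, sub_zero, h1, smul_zero] at key

end Formal

/-! ## §2 Under `A(Y, ω)`, an `𝔰𝔩₂`-lowering for `ω` preserves algebraic classes -/

section StandardA

variable {N : ℕ} {Y : SchemeOver ℂ}

/-- **Under `A(Y, ω)` an `𝔰𝔩₂`-lowering operator for `ω` sends algebraic classes to algebraic classes** (the heart of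
`A(X × X) ⇒ B(X)`, Grothendieck §3 p. 196 / Kleiman 1968 Thm. 2.9: the operator `Λ` is expressed through `L` by the
`𝔰𝔩₂` relation, and `A` says `L` is invertible ON ALGEBRAIC CLASSES). Let `Y` be
smooth projective of dimension `N`, `ω ∈ N¹ H²(Y(ℂ); ℂ)` a divisor class with `A(Y, ω)`, and `Λ` any family of operators
`Hᵈ → Hᵈ⁻²` with `[L_ω, Λ] = deg - N` (hypotheses `hR`, `hR₁`). Then `Λ (Nᵖ H²ᵖ) ⊆ Nᵖ⁻¹ H²ᵖ⁻²` for every `p ≥ 1`.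
Strong induction on `p`. Below the middle (`2p ≤ N`, `2p + w = N`): `L^{w+1} x` is algebraic, so by `A` it is
`L^{w+2} x''` with `x''` algebraic of codimension `p - 1`; `x - L x''` is killed by `L^{w+1}`, hence by `Λ` (§1), and
`Λ L x'' = L Λ x'' - (2p - 2 - N) x''` is algebraic by induction. Above the middle (`2p > N`): `x = Lʳ x''` by `A` with
`x''` algebraic of codimension `N - p < p`, and `Λ Lʳ x'' = Lʳ Λ x'' - r (2(N-p) - N + r - 1) L^{r-1} x''` is algebraic by
induction. [cite: Kleiman1968AlgebraicCycles, Thm. 2.9] [cite: Grothendieck1968, §3 p. 196 (A(X))]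
[cite: Kleiman1994StandardConjectures, Thm. 4-1] -/
theorem sl2_lowering_mem_algebraicClasses_of_standardConjectureA (hY : IsSmoothProjective N Y)
    {ω : complexBetti Y 2} (hω : ω ∈ algebraicClasses Y 1) (hA : StandardConjectureA N Y ω)
    (Λ : (a b : ℕ) → complexBetti Y a →ₗ[ℂ] complexBetti Y b)
    (hR : ∀ {c d e : ℕ} (hcd : c + 2 * 1 = d) (hde : d + 2 * 1 = e) (y : complexBetti Y d),
      lefschetzPowTo ω 1 c d hcd (Λ d c y) - Λ e d (lefschetzPowTo ω 1 d e hde y) =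
        ((((d : ℤ) - N) : ℤ) : ℂ) • y)
    (hR₁ : ∀ {d e : ℕ} (_ : d ≤ 1) (hde : d + 2 * 1 = e) (y : complexBetti Y d),
      Λ e d (lefschetzPowTo ω 1 d e hde y) = ((((N : ℤ) - d) : ℤ) : ℂ) • y)
    (p : ℕ) : ∀ {p' : ℕ} (_ : p' + 1 = p) {x : complexBetti Y (2 * p)} (_ : x ∈ algebraicClasses Y p),
      Λ (2 * p) (2 * p') x ∈ algebraicClasses Y p' := by
  induction p using Nat.strong_induction_on with | _ p ih => ?_
  intro p' hp x hx
  -- `Λ (L y) ∈ N^{l+1}` for `y ∈ Nˡ` with `l < p` (the relation and the induction hypothesis)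
  have hΛL : ∀ {l l₁ : ℕ} (_ : l < p) (hl : 2 * l + 2 * 1 = 2 * l₁) {y : complexBetti Y (2 * l)}
      (_ : y ∈ algebraicClasses Y l), Λ (2 * l₁) (2 * l) (lefschetzPowTo ω 1 (2 * l) (2 * l₁) hl y) ∈
        algebraicClasses Y l := by
    intro l l₁ hlp hl y hy
    by_cases hl1 : 1 ≤ l
    · obtain ⟨l', hl'⟩ : ∃ l', l' + 1 = l := ⟨l - 1, by omega⟩
      have key := hR (show 2 * l' + 2 * 1 = 2 * l by omega) hl y
      rw [sub_eq_iff_eq_add] at key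
      -- `Λ (L y) = L (Λ y) - (2l - N) y`
      have key' : Λ (2 * l₁) (2 * l) (lefschetzPowTo ω 1 (2 * l) (2 * l₁) hl y) =
          lefschetzPowTo ω 1 (2 * l') (2 * l) (by omega) (Λ (2 * l) (2 * l') y) -
            (((((2 * l : ℕ) : ℤ) - N) : ℤ) : ℂ) • y := by
        rw [key]; abel
      rw [key']
      refine Submodule.sub_mem _ ?_ (Submodule.smul_mem _ _ hy)
      have hmem := lefschetzPowTo_mem_supportedClasses_of_mem hY hω l' (ih l hlp hl' hy) 1 (2 * l) (by omega)
      obtain rfl : l' + 1 = l := hl'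
      exact hmem
    · obtain rfl : l = 0 := by omega
      rw [hR₁ (by omega) hl y]
      exact Submodule.smul_mem _ _ hy
  by_cases hmid : 2 * p ≤ N
  · -- below the middle: `2p + w = N`
    obtain ⟨w, hw⟩ : ∃ w, 2 * p + w = N := ⟨N - 2 * p, by omega⟩
    -- `L^{w+1} x ∈ N^{p+w+1} H^{2(p+w+1)}` is `L^{w+2} x''`, `x'' ∈ N^{p'}`
    have hLx := lefschetzPowTo_mem_supportedClasses_of_mem hY hω p hx (w + 1) (2 * (p + w + 1)) (by omega)
    obtain ⟨x'', hx'', hLx''⟩ := exists_eq_lefschetzPowTo_of_standardConjectureA hA (p := p') (r := w + 2)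
      (q := p + w + 1) (by omega) (by omega) (show 2 * p' + 2 * (w + 2) = 2 * (p + w + 1) by omega) hLx
    -- `x₀ := x - L x''` is killed by `L^{w+1}`, hence by `Λ`
    have hkill : Λ (2 * p) (2 * p') (x - lefschetzPowTo ω 1 (2 * p') (2 * p) (by omega) x'') = 0 := by
      refine sl2_lowering_eq_zero_of_lefschetzPow_eq_zero ω N Λ hR hR₁ (show 2 * p' + 2 = 2 * p by omega) hw
        (show 2 * p + 2 * (w + 1) = 2 * (p + w + 1) by omega) _ ?_
      rw [map_sub, lefschetzPowTo_comp_apply ω (show 1 + (w + 1) = w + 2 by omega)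
        (show 2 * p' + 2 * 1 = 2 * p by omega) (show 2 * p + 2 * (w + 1) = 2 * (p + w + 1) by omega)
        (show 2 * p' + 2 * (w + 2) = 2 * (p + w + 1) by omega) x'', hLx'', sub_self]
    have hsplit : Λ (2 * p) (2 * p') x =
        Λ (2 * p) (2 * p') (lefschetzPowTo ω 1 (2 * p') (2 * p) (by omega) x'') := by
      rw [map_sub, sub_eq_zero] at hkill
      exact hkill
    rw [hsplit]
    exact hΛL (by omega) (by omega) hx''
  · -- above the middle: `x = Lʳ x''`, `r = s + 1 ≥ 1`, `x'' ∈ N^{p̃}`, `p̃ = N - p < p`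
    by_cases hpN : N < p
    · -- no cohomology in degree `2p > 2N`
      haveI := subsingleton_complexBetti hY (show 2 * N < 2 * p by omega)
      rw [Subsingleton.elim x 0, map_zero]
      exact Submodule.zero_mem _
    obtain ⟨s, hs⟩ : ∃ s, N + s + 1 = 2 * p := ⟨2 * p - N - 1, by omega⟩
    obtain ⟨pt, hpt⟩ : ∃ pt, pt + (s + 1) = p := ⟨p - (s + 1), by omega⟩
    obtain ⟨x'', hx'', rfl⟩ := exists_eq_lefschetzPowTo_of_standardConjectureA hA (p := pt) (r := s + 1) (q := p)
      (by omega) (by omega) (show 2 * pt + 2 * (s + 1) = 2 * p by omega) hx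
    by_cases hpt1 : 1 ≤ pt
    · obtain ⟨pt', hpt'⟩ : ∃ pt', pt' + 1 = pt := ⟨pt - 1, by omega⟩
      have key := sl2_lefschetzPow_lowering_sub ω N Λ hR (show 2 * pt' + 2 = 2 * pt by omega) x'' s
        (cs := 2 * p') (ds := 2 * p) (by omega) (by omega) (by omega)
      rw [sub_eq_iff_eq_add] at key
      have key' : Λ (2 * p) (2 * p') (lefschetzPowTo ω (s + 1) (2 * pt) (2 * p)
          (show 2 * pt + 2 * (s + 1) = 2 * p by omega) x'') =
          lefschetzPowTo ω (s + 1) (2 * pt') (2 * p') (by omega) (Λ (2 * pt) (2 * pt') x'') -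
            ((((s : ℤ) + 1) * (((2 * pt : ℕ) : ℤ) - N + s) : ℤ) : ℂ) •
              lefschetzPowTo ω s (2 * pt) (2 * p') (by omega) x'' := by
        rw [key]; abel
      rw [key']
      refine Submodule.sub_mem _ ?_ (Submodule.smul_mem _ _ ?_)
      · have hmem := lefschetzPowTo_mem_supportedClasses_of_mem hY hω pt' (ih pt (by omega) hpt' hx'') (s + 1) (2 * p')
          (by omega)
        obtain rfl : pt' + (s + 1) = p' := by omega
        exact hmem
      · have hmem := lefschetzPowTo_mem_supportedClasses_of_mem hY hω pt hx'' s (2 * p') (by omega)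
        obtain rfl : pt + s = p' := by omega
        exact hmem
    · obtain rfl : pt = 0 := by omega
      rw [sl2_lowering_lefschetzPow_of_le_one ω N Λ hR hR₁ (by omega) x'' s (ds := 2 * p)
        (show 2 * 0 + 2 * (s + 1) = 2 * p by omega) (show 2 * 0 + 2 * s = 2 * p' by omega)]
      refine Submodule.smul_mem _ _ ?_
      have hmem := lefschetzPowTo_mem_supportedClasses_of_mem hY hω 0 hx'' s (2 * p') (by omega)
      obtain rfl : 0 + s = p' := by omega
      exact hmem

end StandardA

/-! ## §3 Orthogonality of Lefschetz strings; the lowering operator is self-adjoint in complementary degrees -/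

section SelfAdjoint

variable {Y : Type u} [TopologicalSpace Y] {R : Type} [CommRing R] {κ : singularCohomology R R Y 2} {n : ℕ}

/-- **Lefschetz strings of different primitive degrees are cup-orthogonal**: for `x ∈ Pⁱ`, `x' ∈ P^{i'}` primitive
with `i ≠ i'`, `Lˢ x ∪ Lᵗ x' = 0` in the top degree `2n` — move all powers of `κ` onto the factor of larger primitive
degree, which is then hit by `L^{≥ n - deg + 1}` and dies (Voisin I Lemma 6.31, proof; `i ≡ i' (mod 2)` is forced by
the degrees). [cite: VoisinHodgeI2002, §6.3.2 Lemma 6.31] [cite: HatcherAT2002, §3.2 Thm. 3.11] -/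
theorem cupProduct_lefschetzPowTo_eq_zero_of_ne {i i' s t a b : ℕ} (hne : i ≠ i') (ha : i + 2 * s = a)
    (hb : i' + 2 * t = b) (h : a + b = 2 * n) {x : singularCohomology R R Y i} {x' : singularCohomology R R Y i'}
    (hx : x ∈ primitiveClasses κ n i) (hx' : x' ∈ primitiveClasses κ n i') :
    cupProduct h (lefschetzPowTo κ s i a ha x) (lefschetzPowTo κ t i' b hb x') = 0 := by
  rcases Nat.lt_or_gt_of_ne hne with hlt | hgt
  · rw [cupProduct_lefschetzPowTo_lefschetzPowTo κ s t ha hb h (show i' + 2 * (s + t) = i' + 2 * (s + t) from rfl)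
      (by omega), lefschetzPowTo_eq_zero_of_mem_primitiveClasses hx' _ (by omega), map_zero]
  · rw [cupProduct_gradedComm_holds R Y h (show b + a = 2 * n by omega),
      cupProduct_lefschetzPowTo_lefschetzPowTo κ t s hb ha (show b + a = 2 * n by omega)
      (show i + 2 * (t + s) = i + 2 * (t + s) from rfl) (by omega),
      lefschetzPowTo_eq_zero_of_mem_primitiveClasses hx _ (by omega), map_zero, smul_zero]

variable (hL : HasHardLefschetzProperty κ n) (hvan : ∀ m, 2 * n < m → Subsingleton (singularCohomology R R Y m))
  (Λ : (a b : ℕ) → singularCohomology R R Y a →ₗ[R] singularCohomology R R Y b)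
  (hS : ∀ (a t i j : ℕ) (h₁ : a + 2 * (t + 1) = i) (h₂ : a + 2 * t = j) (x : singularCohomology R R Y a),
    x ∈ primitiveClasses κ n a →
      Λ i j (lefschetzPowTo κ (t + 1) a i h₁ x) =
        ((((t : ℤ) + 1) * ((n : ℤ) - a - t) : ℤ) : R) • lefschetzPowTo κ t a j h₂ x)
  (hP : ∀ (a b : ℕ) (x : singularCohomology R R Y a), x ∈ primitiveClasses κ n a → Λ a b x = 0)

include hL hvan hS hP in
/-- **Kleiman's lowering operator is self-adjoint for the cup product in complementary degrees**: for the family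
`Λ` with the string formulas (`Λ (Lᵗ⁺¹ x) = (t+1)(n-a-t) Lᵗ x`, `Λ x = 0` for `x` primitive) and classes `c ∈ Hᵃ`,
`y ∈ Hᵏ` with `a + k = 2n + 2`, `c ∪ Λ y = Λ c ∪ y` in `H²ⁿ(Y; R)`. On strings `c = Lˢ x`, `y = Lᵗ x'` (`x ∈ Pⁱ`,
`x' ∈ P^{i'}`; `lefschetz_span_induction` twice) both sides vanish for `i ≠ i'` (orthogonality), and for `i = i'`
both equal `(t(n-i-t+1)) x ∪ L^{s+t-1} x'` since `s + t = n - i + 1` makes `t(n-i-t+1) = s(n-i-s+1)`. (Kleiman 1968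
§1.4: `Λ` is the adjoint of `L` for the form `⟨x, *y⟩`, and `ᵗΛ = Λ` up to the sign conventions, which are absent for
André's sign-free `*_L`.) [cite: Kleiman1968AlgebraicCycles, §1.4] [cite: VoisinHodgeI2002, §6.3.2 Lemma 6.31] -/
theorem sl2Lowering_cupProduct_comm {a a' k k' : ℕ} (ha : a' + 2 = a) (hk : k' + 2 = k) (h₁ : a + k' = 2 * n)
    (h₂ : a' + k = 2 * n) (c : singularCohomology R R Y a) (y : singularCohomology R R Y k) :
    cupProduct h₁ c (Λ k k' y) = cupProduct h₂ (Λ a a' c) y := by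
  induction c using lefschetz_span_induction hL hvan with
  | h0 => simp
  | hadd c c' hc hc' => rw [map_add, map_add, LinearMap.add_apply, map_add, LinearMap.add_apply, hc, hc']
  | hprim i s hsa x hx his =>
    induction y using lefschetz_span_induction hL hvan with
    | h0 => simp
    | hadd y y' hy hy' => rw [map_add, map_add, map_add, hy, hy']
    | hprim i' t htk x' hx' hit =>
      rcases t with _ | t₀
      · -- `y = x'` primitive: `Λ y = 0`
        obtain rfl : k = i' := by omega
        rw [lefschetzPowTo_zero_apply, hP _ _ x' hx', map_zero]
        rcases s with _ | s₀
        · obtain rfl : a = i := by omega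
          rw [lefschetzPowTo_zero_apply, hP _ _ x hx, map_zero, LinearMap.zero_apply]
        · rw [hS i s₀ a a' hsa (by omega) x hx, map_smul, LinearMap.smul_apply,
            ← lefschetzPowTo_zero_apply κ k x',
            cupProduct_lefschetzPowTo_eq_zero_of_ne (s := s₀) (t := 0) (a := a') (b := k) (by omega) (by omega)
              (by omega) h₂ hx hx', smul_zero]
      · rw [hS i' t₀ k k' htk (by omega) x' hx', map_smul]
        rcases s with _ | s₀
        · obtain rfl : a = i := by omega
          rw [lefschetzPowTo_zero_apply, hP _ _ x hx, map_zero, LinearMap.zero_apply,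
            ← lefschetzPowTo_zero_apply κ a x,
            cupProduct_lefschetzPowTo_eq_zero_of_ne (s := 0) (t := t₀) (a := a) (b := k') (by omega) (by omega)
              (by omega) h₁ hx hx', smul_zero]
        · rw [hS i s₀ a a' hsa (by omega) x hx, map_smul, LinearMap.smul_apply]
          by_cases hii : i = i'
          · subst hii
            rw [cupProduct_lefschetzPowTo_lefschetzPowTo κ (s₀ + 1) t₀ hsa (by omega) h₁
                (show i + 2 * (s₀ + 1 + t₀) = i + 2 * (s₀ + 1 + t₀) from rfl) (by omega),
              cupProduct_lefschetzPowTo_lefschetzPowTo κ s₀ (t₀ + 1) (by omega) htk h₂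
                (show i + 2 * (s₀ + (t₀ + 1)) = i + 2 * (s₀ + 1 + t₀) by omega) (by omega),
              lefschetzPowTo_congr_exponent κ (show s₀ + (t₀ + 1) = s₀ + 1 + t₀ by omega) _
                (show i + 2 * (s₀ + 1 + t₀) = i + 2 * (s₀ + 1 + t₀) from rfl) x']
            congr 1
            have hn : (n : ℤ) = i + s₀ + t₀ + 1 := by
              have : i + s₀ + t₀ + 1 = n := by omega
              exact_mod_cast this.symm
            rw [hn]
            push_cast
            ring
          · rw [cupProduct_lefschetzPowTo_eq_zero_of_ne hii hsa _ h₁ hx hx',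
              cupProduct_lefschetzPowTo_eq_zero_of_ne hii _ htk h₂ hx hx', smul_zero, smul_zero]

end SelfAdjoint

/-! ## §4 Injective algebraic iterates of the lowering operator (the `ν`-criterion inputs) -/

section Iterate

variable {n : ℕ} {X : SchemeOver ℂ}

/-- **Injective algebraic lowering iterates.** Let `X` be smooth projective of dimension `n`, `η` a class with hard
Lefschetz, `Λ` a lowering family with the string formula `Λ (Lᵗ⁺¹ x) = (t+1)(n-a-t) Lᵗ x` (`x ∈ Pᵃ` primitive), and
suppose `Λ : Hᵃ → Hᵃ⁻²` is an algebraic correspondence in every degree `a ≤ 2n`. Then for `b + r = n` there is an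
INJECTIVE algebraic correspondence `H^{b+2r} → Hᵇ` — namely `Λʳ`: on a string `L^{t+r} x`, `x ∈ Pⁱ`, `i + 2t = b`,
`Λʳ L^{t+r} x = c · Lᵗ x` with `c = ∏ (t+j)(n-i-t-j+1) ≠ 0` (`i + t + r ≤ n`), so by uniqueness of the Lefschetz
decomposition `Λʳ Lʳ w = 0` forces every primitive component of `w ∈ Hᵇ` to vanish (Kleiman 1968 Prop. 2.3,
(Λ) ⇒ (θ): `Λⁿ⁻ⁱ` inverts `Lⁿ⁻ⁱ` on the Lefschetz summands up to non-zero integers).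
[cite: Kleiman1968AlgebraicCycles, §2 Prop. 2.3] [cite: VoisinHodgeI2002, §6.2.3 Cor. 6.26] -/
theorem exists_injective_algebraic_sl2LoweringPow (hX : IsSmoothProjective n X) {η : complexBetti X 2}
    (hL : HasHardLefschetzProperty η n) (Λ : (a b : ℕ) → complexBetti X a →ₗ[ℂ] complexBetti X b)
    (hS : ∀ (a t i j : ℕ) (h₁ : a + 2 * (t + 1) = i) (h₂ : a + 2 * t = j) (x : complexBetti X a),
      x ∈ primitiveClasses η n a →
        Λ i j (lefschetzPowTo η (t + 1) a i h₁ x) =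
          ((((t : ℤ) + 1) * ((n : ℤ) - a - t) : ℤ) : ℂ) • lefschetzPowTo η t a j h₂ x)
    (hΛ : ∀ (a a' : ℕ), a' + 2 = a → a ≤ 2 * n → IsAlgebraicCorrespondence n n X X (Λ a a'))
    {b r : ℕ} (hbr : b + r = n) :
    ∃ F : complexBetti X (b + 2 * r) →ₗ[ℂ] complexBetti X b, IsAlgebraicCorrespondence n n X X F ∧
      Function.Injective F := by
  have hvan : ∀ m, 2 * n < m → Subsingleton (complexBetti X m) := fun m hm ↦ subsingleton_complexBetti hX hm
  -- `Λʳ : Hᵐ → Hᵇ` is algebraic and acts on strings by a non-zero integer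
  have claim : ∀ (r b m : ℕ) (hm : b + 2 * r = m), m ≤ 2 * n →
      ∃ F : complexBetti X m →ₗ[ℂ] complexBetti X b, IsAlgebraicCorrespondence n n X X F ∧
        ∀ (t i : ℕ) (h : i + 2 * t = b), i + t + r ≤ n → ∃ c : ℤ, c ≠ 0 ∧
          ∀ x ∈ primitiveClasses η n i,
            F (lefschetzPowTo η (t + r) i m (by omega) x) = (c : ℂ) • lefschetzPowTo η t i b h x := by
    intro r
    induction r with
    | zero =>
      intro b m hm hmn
      obtain rfl : m = b := by omega
      refine ⟨LinearMap.id, isAlgebraicCorrespondence_id hX hmn, fun t i h _ ↦ ⟨1, one_ne_zero, fun x _ ↦ ?_⟩⟩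
      rw [LinearMap.id_apply, Int.cast_one, one_smul, lefschetzPowTo_congr_exponent η (Nat.add_zero t) _ h x]
    | succ r ih =>
      intro b m hm hmn
      obtain ⟨F₀, hF₀, hF₀s⟩ := ih b (b + 2 * r) rfl (by omega)
      refine ⟨F₀ ∘ₗ Λ m (b + 2 * r), ?_, fun t i h hit ↦ ?_⟩
      · exact AbelianAll.IsAlgebraicCorrespondence.comp hX hX hX (hΛ m (b + 2 * r) (by omega) hmn) hF₀ (by omega)
      · obtain ⟨c₀, hc₀, hc₀F⟩ := hF₀s t i h (by omega)
        refine ⟨(((t : ℤ) + r) + 1) * ((n : ℤ) - i - (t + r : ℕ)) * c₀, ?_, fun x hx ↦ ?_⟩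
        · refine mul_ne_zero (mul_ne_zero ?_ ?_) hc₀
          · omega
          · push_cast
            omega
        · rw [LinearMap.comp_apply,
            lefschetzPowTo_congr_exponent η (show t + (r + 1) = t + r + 1 by omega) _
              (show i + 2 * (t + r + 1) = m by omega) x,
            hS i (t + r) m (b + 2 * r) (by omega) (by omega) x hx, map_smul, hc₀F x hx, smul_smul]
          congr 1
          push_cast
          ring
  obtain ⟨F, hF, hFs⟩ := claim r b (b + 2 * r) rfl (by omega)
  refine ⟨F, hF, (injective_iff_map_eq_zero F).mpr fun v hv ↦ ?_⟩
  -- `v = Lʳ w`, `w ∈ Hᵇ` (hard Lefschetz in degree `b = n - r`)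
  obtain ⟨w, rfl⟩ := (hL r b hbr).2 v
  rw [← lefschetzPowTo_eq_lefschetzPow] at hv
  have hw := sum_lefschetzPowTo_primitivePart hL hvan w
  choose c hc0 hc using fun p : {p : ℕ × ℕ // p.1 + 2 * p.2 = b} ↦
    hFs p.1.2 p.1.1 p.2 (by have := p.2; omega)
  -- `F (Lʳ w) = ∑_p c_p • L^{t_p} ξ_p(w)`
  have key : F (lefschetzPowTo η r b (b + 2 * r) rfl w) =
      ∑ p, lefschetzPowTo η p.1.2 p.1.1 b p.2 ((c p : ℂ) • primitivePart η n hL hvan p w) := by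
    conv_lhs => rw [← hw]
    rw [map_sum, map_sum]
    refine Finset.sum_congr rfl fun p _ ↦ ?_
    rw [lefschetzPowTo_lefschetzPowTo η r p.2 rfl (show p.1.1 + 2 * (p.1.2 + r) = b + 2 * r by have := p.2; omega),
      hc p _ (primitivePart_mem hL hvan p w), map_smul]
  -- uniqueness of the Lefschetz decomposition of `0 = F (Lʳ w)`
  have hξ : ∀ p, primitivePart η n hL hvan p w = 0 := by
    intro p
    have h0 := primitivePart_eq_of_sum_eq hL hvan (y := fun p ↦ (c p : ℂ) • primitivePart η n hL hvan p w)
      (fun p ↦ Submodule.smul_mem _ _ (primitivePart_mem hL hvan p w))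
      (fun p hp ↦ by rw [primitivePart_of_lt hL hvan p hp, LinearMap.zero_apply, smul_zero]) (by rw [← key, hv]) p
    rw [map_zero] at h0
    exact (smul_eq_zero.mp h0.symm).resolve_left (Int.cast_ne_zero.mpr (hc0 p))
  have hw0 : w = 0 := by
    rw [← hw]
    exact Finset.sum_eq_zero fun p _ ↦ by rw [hξ p, map_zero]
  rw [hw0, map_zero]

end Iterate

end Summit.HodgeConjecture.HodgeConjecture.Ring2.AbelianAll

end
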